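import Summits.BirchSwinnertonDyer.BirchSwinnertonDyer.Theorems.ErratumRoadFiveAuxPrimeSupply
import Summits.BirchSwinnertonDyer.BirchSwinnertonDyer.Theorems.ErratumRoadFiveAuxNormReceptacleDefs
import HarnessLib

/-!
# (O) `SplitPrimeKummerWitness` — the Kummer witness of a split prime and the order law (v15 stub)

Helper file for crux `stmt-BirchSwinnertonDyer-19715`, line `aux_norm_receptacle` / skeleton v15 (LEAD bsd-line-er5-p1 g3,
`Theorems/ErratumRoadFiveAuxNormReceptacleDefs.lean`): proves the registered-to-be stub header
`stub_splitPrimeKummerWitness : … → AuxNormReceptacle.SplitPrimeKummerWitness K p q` (seat bsd-line-er5-p1-w2 g5, step F6).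
`W`-free, `ι`-free algebraic number theory of the imaginary quadratic `K`. Sorry-free; nothing here closes 19715; BSD is proved for no curve.

Witness (for `q𝓞_K = 𝔮 · τ𝔮` split, `h = ord [𝔮]`, `𝔮^h = (β)`): `γ := β² q^{h(p-1)}`, `r := q^{2h}` (`N(γ) = N(β)² q^{2h(p-1)} = q^{2hp}`),
`T₀ := {q}`; `γ ∉ K^{×p}` by `not_exists_pow_mul_norm_eq_sq` (F3b-1: `y^p = γ` gives `(±y/q^h)^p N(β) = β²`).  For `ℓ₀ ≠ q` inert with
`p^E ∣ ℓ₀+1` (`E ≥ 1`) and `γ` not a `p`-th power mod `ℓ₀`: `β^{(ℓ₀²-1)/p} ≢ 1` (else, in the cyclic group `(𝓞_K/ℓ₀)^×` of order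
`ℓ₀² - 1`, `β ≡ w^p`, and `q ≡ z^p` as `gcd(p, ℓ₀ - 1) = 1`, so `γ ≡ (w² z^{h(p-1)})^p`), whence `p^E ∣ ord [𝔮]_{ℓ₀}` by F1
(`RingClass.pow_dvd_orderOf_primeClass_of_inert`) and `ord [τ𝔮]_{ℓ₀} = ord [𝔮]_{ℓ₀}` (`[𝔮][τ𝔮] = 1`).

References: D. A. Cox, *Primes of the form x² + ny²* (2013), §7.C–D [Cox2013]; B. H. Gross, LMS LNS 153 (1991), §3 [GrossLMS1991].
-/

noncomputable section

set_option linter.dupNamespace false -- `Summit.BirchSwinnertonDyer.BirchSwinnertonDyer` (summit = problem), tree-wide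

open scoped Classical NumberField Pointwise nonZeroDivisors
open NumberField Field IsDedekindDomain
open Literature.NumberTheory.EllipticCurves
open Literature.NumberTheory.NumberFields.RingClassField Literature.NumberTheory.QuadraticFields

namespace Summit.BirchSwinnertonDyer.BirchSwinnertonDyer.Theorems

namespace AuxPrimeSupply

/-- In a finite cyclic group of order `p · k`, an element killed by `k` is a `p`-th power. [folklore] -/
theorem exists_pow_eq_of_pow_eq_one {G : Type*} [Group G] [IsCyclic G] [Finite G] {p k : ℕ} (hk : k ≠ 0)
    (hcard : Nat.card G = p * k) {x : G} (hx : x ^ k = 1) : ∃ w : G, w ^ p = x := by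
  obtain ⟨g, hg⟩ := IsCyclic.exists_generator (α := G)
  have hord : orderOf g = p * k := (orderOf_eq_card_of_forall_mem_zpowers hg).trans hcard
  obtain ⟨a, rfl⟩ := Subgroup.mem_zpowers_iff.mp (hg x)
  have hdvd : ((p * k : ℕ) : ℤ) ∣ a * k := by
    rw [← hord, orderOf_dvd_iff_zpow_eq_one, zpow_mul]
    exact_mod_cast hx
  have hpa : (p : ℤ) ∣ a := by
    have hk' : (k : ℤ) ≠ 0 := by exact_mod_cast hk
    refine Int.dvd_of_mul_dvd_mul_right hk' ?_
    push_cast at hdvd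
    exact hdvd
  obtain ⟨a', rfl⟩ := hpa
  exact ⟨g ^ a', by rw [← zpow_natCast, ← zpow_mul, mul_comm]⟩

/-- In a monoid, if `x ^ d = 1` with `gcd(p, d) = 1` then `x` is a `p`-th power (`x = (x^s)^p`, `p s ≡ 1 (mod d)`). [folklore] -/
theorem exists_pow_eq_of_pow_eq_one_of_coprime {M : Type*} [Monoid M] {p d : ℕ} (hpd : Nat.Coprime p d)
    (hd : 0 < d) {x : M} (hx : x ^ d = 1) : ∃ z : M, z ^ p = x := by
  by_cases hd1 : d = 1
  · subst hd1
    rw [pow_one] at hx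
    exact ⟨1, by rw [one_pow, hx]⟩
  · have hd2 : 1 < d := by omega
    obtain ⟨s, -, hs⟩ := Nat.exists_mul_mod_eq_one_of_coprime hpd hd2
    refine ⟨x ^ s, ?_⟩
    rw [← pow_mul, mul_comm, ← Nat.div_add_mod (p * s) d, hs, pow_add, pow_mul, hx, one_pow, one_mul,
      pow_one]

/-- An integer `a` prime to the prime `ℓ` has `a^{ℓ-1} ≡ 1 (mod ℓ𝓞_K)` (Fermat, pushed into `𝓞_K`). [folklore] -/
theorem natCast_pow_sub_one_sub_one_mem_span {K : Type*} [Field K] {ℓ a : ℕ} (hℓ : ℓ.Prime)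
    (ha : Nat.Coprime a ℓ) : ((a : 𝓞 K)) ^ (ℓ - 1) - 1 ∈ Ideal.span {(ℓ : 𝓞 K)} := by
  have hF : (a : ℤ) ^ (ℓ - 1) ≡ 1 [ZMOD (ℓ : ℤ)] :=
    Int.ModEq.pow_card_sub_one_eq_one hℓ (Nat.isCoprime_iff_coprime.mpr ha)
  obtain ⟨k, hk⟩ := (Int.ModEq.dvd hF.symm)
  rw [Ideal.mem_span_singleton]
  refine ⟨(k : 𝓞 K), ?_⟩
  have := congrArg (fun z : ℤ => (z : 𝓞 K)) hk
  push_cast at this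
  linear_combination this

/-- **The residue conversion at an inert prime.** `K` quadratic, `ℓ` a rational prime inert in `K` with `p ∣ ℓ + 1`,
`p ∤ ℓ - 1` (`p` prime), `β, q ∈ 𝓞_K` prime to `ℓ` (`q` a rational integer).  If `β^{(ℓ²-1)/p} ≡ 1 (mod ℓ𝓞_K)` then
`β² q^n` is a `p`-th power modulo `ℓ𝓞_K` for every `n` (`(𝓞_K/ℓ)^×` is cyclic of order `ℓ² - 1`, and `q ≡ z^p` as
`q^{ℓ-1} ≡ 1`). [cite: Cox2013, §7.D (7.27) ((𝒪_K/ℓ𝒪_K)^* for an inert ℓ)] -/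
theorem exists_pow_sub_mem_span_of_pow_div_sub_one_mem {K : Type} [Field K] [NumberField K]
    (hK2 : Module.finrank ℚ K = 2) {ℓ : ℕ} (hℓ : ℓ.Prime) (hℓP : (Ideal.span {(ℓ : 𝓞 K)}).IsPrime)
    {p : ℕ} (hp : p.Prime) (hpℓ : p ∣ ℓ + 1) (hpℓ' : ¬ p ∣ ℓ - 1) {β : 𝓞 K}
    (hβ : Ideal.span {β} ⊔ Ideal.span {(ℓ : 𝓞 K)} = ⊤) {q : ℕ} (hq : Nat.Coprime q ℓ) (n : ℕ)
    (hk : β ^ ((ℓ ^ 2 - 1) / p) - 1 ∈ Ideal.span {(ℓ : 𝓞 K)}) :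
    ∃ y : 𝓞 K, y ^ p - β ^ 2 * (q : 𝓞 K) ^ n ∈ Ideal.span {(ℓ : 𝓞 K)} := by
  classical
  set I := Ideal.span {(ℓ : 𝓞 K)} with hI
  have hne : I ≠ ⊥ := by rw [hI, Ne, Ideal.span_singleton_eq_bot]; exact_mod_cast hℓ.ne_zero
  haveI hmax : I.IsMaximal := hℓP.isMaximal hne
  letI : Field (𝓞 K ⧸ I) := Ideal.Quotient.field I
  haveI : Finite (𝓞 K ⧸ I) := Ideal.finiteQuotientOfFreeOfNeBot I hne
  -- `#(𝓞_K/ℓ)^× = ℓ² - 1 = p · k`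
  have hsq : ℓ ^ 2 - 1 = (ℓ + 1) * (ℓ - 1) := by
    obtain ⟨j, rfl⟩ : ∃ j, ℓ = j + 1 := ⟨ℓ - 1, (Nat.sub_add_cancel hℓ.one_le).symm⟩
    rw [Nat.add_sub_cancel]
    exact Nat.sub_eq_of_eq_add (by ring)
  have hpdvd : p ∣ ℓ ^ 2 - 1 := by rw [hsq]; exact hpℓ.mul_right _
  obtain ⟨k, hk'⟩ := hpdvd
  have hkdiv : (ℓ ^ 2 - 1) / p = k := by rw [hk', Nat.mul_div_cancel_left _ hp.pos]
  have hk0 : k ≠ 0 := by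
    intro h0
    rw [h0, mul_zero] at hk'
    have : 2 ^ 2 ≤ ℓ ^ 2 := Nat.pow_le_pow_left hℓ.two_le 2
    omega
  have hcardU : Nat.card (𝓞 K ⧸ I)ˣ = p * k := by
    rw [Nat.card_units, RingClass.natCard_quot_span_natCast hK2, hk']
  -- `β ≡ w^p`
  set π := Ideal.Quotient.mk I with hπ
  have hβu : IsUnit (π β) := RingClass.isUnit_mk_of_sup_eq_top hβ
  have hβk : hβu.unit ^ k = 1 := by
    apply Units.ext
    rw [Units.val_pow_eq_pow_val, IsUnit.unit_spec, Units.val_one, ← hkdiv, ← map_pow, ← π.map_one,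
      hπ, Ideal.Quotient.eq]
    exact hk
  obtain ⟨w, hw⟩ := exists_pow_eq_of_pow_eq_one hk0 hcardU hβk
  have hwβ : (w : 𝓞 K ⧸ I) ^ p = π β := by
    rw [← Units.val_pow_eq_pow_val, hw, IsUnit.unit_spec]
  -- `q ≡ z^p`
  have hqF : (π (q : 𝓞 K)) ^ (ℓ - 1) = 1 := by
    rw [← map_pow, ← π.map_one, hπ, Ideal.Quotient.eq]
    exact natCast_pow_sub_one_sub_one_mem_span hℓ hq
  have hcop : Nat.Coprime p (ℓ - 1) := (Nat.Prime.coprime_iff_not_dvd hp).mpr hpℓ'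
  obtain ⟨z, hz⟩ := exists_pow_eq_of_pow_eq_one_of_coprime hcop (by have := hℓ.two_le; omega) hqF
  -- lift `y₀ = w² z^n`
  obtain ⟨y, hy⟩ := Ideal.Quotient.mk_surjective (I := I) ((w : 𝓞 K ⧸ I) ^ 2 * z ^ n)
  refine ⟨y, ?_⟩
  rw [← Ideal.Quotient.eq, ← hπ, map_pow, hy, mul_pow, ← pow_mul, mul_comm 2 p, pow_mul, hwβ, ← pow_mul,
    mul_comm n p, pow_mul, hz, map_mul, map_pow, map_pow]

end AuxPrimeSupply

/-! ### The v15 stub (O) -/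

/-- **(O) `SplitPrimeKummerWitness K p q`** — the v15 stub header of LEAD bsd-line-er5-p1 g3 (HOME STATUS 15:15:19Z), proved
for `K` imaginary quadratic with `d_K < -4`, `p ≥ 3` prime, `q` a rational prime split in `K` (`#{𝔓 ∣ q} = 2`): with
`q𝓞_K = 𝔮 · τ𝔮`, `h = ord [𝔮]`, `𝔮^h = (β)`, the witness `γ = β² q^{h(p-1)}`, `r = q^{2h}`, `T₀ = {q}` works —
`N(γ) = r^p`, `γ ∉ K^{×p}` (F3b-1), and for `ℓ₀ ≠ q` inert with `p^E ∣ ℓ₀ + 1` and `γ` not a `p`-th power mod `ℓ₀`: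
`p^E ∣ ord [𝔭_v]_{ℓ₀}` for both `v ∣ q` (F1 + `[𝔮][τ𝔮] = 1`). [cite: Cox2013, §7.C Prop. 7.22, §7.D (7.27), §9.A Lemma 9.3] -/
theorem stub_splitPrimeKummerWitness (K : Type) [Field K] [NumberField K]
    (hK : Literature.NumberTheory.EllipticCurves.IsImaginaryQuadratic K) (hdK : NumberField.discr K < -4)
    (p : ℕ) [Fact p.Prime] (hp3 : 3 ≤ p) (q : ℕ) [Fact q.Prime]
    (hq2 : ((Ideal.span {(q : ℤ)}).primesOver (NumberField.RingOfIntegers K)).ncard = 2) :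
    Summit.BirchSwinnertonDyer.BirchSwinnertonDyer.Theorems.AuxNormReceptacle.SplitPrimeKummerWitness K p q := by
  classical
  intro E
  have hp : p.Prime := Fact.out
  have hq : q.Prime := Fact.out
  have hp2 : p ≠ 2 := by omega
  have hpodd : Odd p := hp.odd_of_ne_two hp2
  have hK2 := hK.1
  haveI : Algebra.IsQuadraticExtension ℚ K := ⟨hK2⟩
  -- the split primes, `h = ord [𝔮]`, `𝔮^h = (β)`
  obtain ⟨τ, v₁, v₂, hτ, hv12, hv₂, hfac, hqv₁, hall⟩ := AuxPrimeSupply.exists_split_primes hK2 hq hq2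
  set c₁ := ClassGroup.mk0 ⟨v₁.asIdeal, mem_nonZeroDivisors_iff_ne_zero.mpr v₁.ne_bot⟩ with hc₁
  set h := orderOf c₁ with hh
  have hh0 : 0 < h := orderOf_pos c₁
  have hord : ∀ n : ℕ, c₁ ^ n = 1 → h ∣ n := fun n hn ↦ orderOf_dvd_of_pow_eq_one hn
  obtain ⟨β, hβ⟩ : ∃ β : 𝓞 K, v₁.asIdeal ^ h = Ideal.span {β} := by
    have hmk : (⟨v₁.asIdeal, mem_nonZeroDivisors_iff_ne_zero.mpr v₁.ne_bot⟩ : (Ideal (𝓞 K))⁰) ^ h =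
        ⟨v₁.asIdeal ^ h, mem_nonZeroDivisors_iff_ne_zero.mpr (pow_ne_zero h v₁.ne_bot)⟩ :=
      Subtype.ext (by rw [SubmonoidClass.coe_pow])
    have h1 : ClassGroup.mk0 ⟨v₁.asIdeal ^ h,
        mem_nonZeroDivisors_iff_ne_zero.mpr (pow_ne_zero h v₁.ne_bot)⟩ = 1 := by
      rw [← hmk, map_pow]
      exact pow_orderOf_eq_one c₁
    obtain ⟨⟨β, hβ⟩⟩ := (ClassGroup.mk0_eq_one_iff _).mp h1
    exact ⟨β, hβ⟩
  have hβ0 : β ≠ 0 := by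
    intro h0
    refine pow_ne_zero h v₁.ne_bot ?_
    rw [hβ, h0]
    exact Ideal.span_singleton_eq_bot.mpr rfl
  have hq0 : (q : 𝓞 K) ≠ 0 := by exact_mod_cast hq.ne_zero
  have hqK0 : (q : K) ≠ 0 := by exact_mod_cast hq.ne_zero
  -- `|N(β)| = q^h`
  have hNv : Ideal.absNorm v₁.asIdeal = q := AuxPrimeSupply.absNorm_eq_of_split hK2 hq hfac
  have hNabs := AuxPrimeSupply.natAbs_norm_eq_of_pow_eq_span hNv hβ
  have hNsq : ((Algebra.norm ℤ β : ℤ) : ℚ) ^ 2 = (q : ℚ) ^ (2 * h) := by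
    rcases Int.natAbs_eq_iff.mp hNabs with hN | hN
    · rw [hN]; push_cast; ring
    · rw [hN]; push_cast; ring
  -- the witness
  set γ : 𝓞 K := β ^ 2 * (q : 𝓞 K) ^ (h * (p - 1)) with hγ
  have hγ0 : γ ≠ 0 := mul_ne_zero (pow_ne_zero 2 hβ0) (pow_ne_zero _ hq0)
  have hγK : (γ : K) = (β : K) ^ 2 * (q : K) ^ (h * (p - 1)) := by
    rw [hγ]; push_cast; rfl
  have hpm : h * p = h * (p - 1) + h := by
    obtain ⟨m, hm⟩ : ∃ m, p = m + 1 := ⟨p - 1, (Nat.sub_add_cancel hp.one_le).symm⟩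
    rw [hm, Nat.add_sub_cancel]; ring
  refine ⟨γ, (q : ℚ) ^ (2 * h), {q}, hγ0, ?_, ?_, ?_⟩
  · -- `N(γ) = (q^{2h})^p`
    rw [hγK, map_mul, map_pow, map_pow, ← Algebra.coe_norm_int, hNsq,
      show (q : K) = algebraMap ℚ K (q : ℚ) by rw [map_natCast], Algebra.norm_algebraMap, hK2]
    rw [← pow_mul, ← pow_mul, ← pow_add]
    congr 1
    rw [mul_assoc 2 h p, hpm]
    ring
  · -- `γ ∉ K^{×p}`
    intro y hy
    apply AuxPrimeSupply.not_exists_pow_mul_norm_eq_sq hK2 hq hv12 hfac hh0 hord hβ hp hp2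
    rw [hγK] at hy
    -- `y^p = β² q^{h(p-1)}`; `N(β) = ± q^h`
    rcases Int.natAbs_eq_iff.mp hNabs with hN | hN
    · refine ⟨y / (q : K) ^ h, ?_⟩
      rw [hN, div_pow, ← pow_mul, RingOfIntegers.coe_eq_algebraMap] at *
      push_cast
      rw [hy, hpm, pow_add]
      field_simp
    · refine ⟨-(y / (q : K) ^ h), ?_⟩
      rw [hN, Odd.neg_pow hpodd, div_pow, ← pow_mul, RingOfIntegers.coe_eq_algebraMap] at *
      push_cast
      rw [hy, hpm, pow_add]
      field_simp
  · -- the order law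
    intro ℓ₀ hℓ₀ hℓ₀q hinert hpE hno v hv
    simp only [Finset.mem_singleton] at hℓ₀q
    rcases Nat.eq_zero_or_pos E with hE0 | hEpos
    · rw [hE0, pow_zero]; exact one_dvd _
    have hpℓ : p ∣ ℓ₀ + 1 := (dvd_pow_self p hEpos.ne').trans hpE
    have hpℓ' : ¬ p ∣ ℓ₀ - 1 := by
      intro hd
      have h2 : p ∣ (ℓ₀ + 1) - (ℓ₀ - 1) := Nat.dvd_sub hpℓ hd
      have h3 : (ℓ₀ + 1) - (ℓ₀ - 1) = 2 := by have := hℓ₀.one_le; omega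
      rw [h3] at h2
      have := Nat.le_of_dvd two_pos h2
      omega
    -- `𝔮 = v₁` is prime to `ℓ₀`
    have hcopq : Nat.Coprime q ℓ₀ := (Nat.coprime_primes hq hℓ₀).mpr (Ne.symm hℓ₀q)
    have hv₁cop : v₁.asIdeal ⊔ Ideal.span {(ℓ₀ : 𝓞 K)} = ⊤ := by
      refine (sup_span_eq_top_iff_not_le ℓ₀).mpr ?_
      intro hle
      have hmem : (ℓ₀ : 𝓞 K) ∈ v₁.asIdeal := hle (Ideal.mem_span_singleton_self _)
      obtain ⟨a, b, hab⟩ : IsCoprime (ℓ₀ : ℤ) (q : ℤ) := Nat.isCoprime_iff_coprime.mpr hcopq.symm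
      have h1 : ((a * ℓ₀ + b * q : ℤ) : 𝓞 K) ∈ v₁.asIdeal := by
        push_cast
        exact v₁.asIdeal.add_mem (v₁.asIdeal.mul_mem_left _ hmem) (v₁.asIdeal.mul_mem_left _ hqv₁)
      rw [hab, Int.cast_one] at h1
      exact v₁.isPrime.ne_top ((Ideal.eq_top_iff_one _).mpr h1)
    have hβcop : Ideal.span {β} ⊔ Ideal.span {(ℓ₀ : 𝓞 K)} = ⊤ :=
      RingClass.span_sup_eq_top_of_pow_eq_span hv₁cop hβ
    -- the residue condition on `β`
    have hkum : β ^ ((ℓ₀ ^ 2 - 1) / p) - 1 ∉ Ideal.span {(ℓ₀ : 𝓞 K)} := by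
      intro hk
      apply hno
      obtain ⟨y, hy⟩ := AuxPrimeSupply.exists_pow_sub_mem_span_of_pow_div_sub_one_mem hK2 hℓ₀ hinert hp hpℓ
        hpℓ' hβcop hcopq (h * (p - 1)) hk
      exact ⟨y, by rw [hγ]; exact hy⟩
    have hdiv₁ : p ^ E ∣ orderOf (primeClass ℓ₀ v₁) :=
      RingClass.pow_dvd_orderOf_primeClass_of_inert hK2 hdK hℓ₀ hinert hp hpE hpℓ' hv₁cop hβ hkum
    rcases hall v hv with hv' | hv'
    · rw [hv']; exact hdiv₁
    · rw [hv']
      have hv₁' : ¬ Ideal.span {(ℓ₀ : 𝓞 K)} ≤ v₁.asIdeal := (sup_span_eq_top_iff_not_le ℓ₀).mp hv₁cop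
      have hmul := RingClass.primeClass_mul_primeClass_eq_one_of_smul hK2 τ hτ ℓ₀ hv₂ hv₁'
      have heq : primeClass ℓ₀ v₂ = (primeClass ℓ₀ v₁)⁻¹ := eq_inv_of_mul_eq_one_right hmul
      rw [heq, orderOf_inv]
      exact hdiv₁

end Summit.BirchSwinnertonDyer.BirchSwinnertonDyer.Theorems

end
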